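/-
Copyright: the b2b-balaban T⁴-continuum CRUX team, row NE7b OWNER lineage `t4-ne7b-p1` (gen 130). Project licence.
-/
import Literature.Probability.LatticeModels.LocalPerturbationPolymerGas

/-!
# A CLUSTER THROUGH TWO FAR-APART CELLS IS LARGE: the union of a polymer cluster (a family of `R`-connected cell sets that cannot be split
# into two mutually compatible parts) is `R`-connected; along an `R`-path a potential `d : V → ℕ` with `d(y) ≤ d(x)+1` across every edge
# takes every intermediate value; so a cluster touching `{a}` and `{b}` with `d(a) = 0`, `d(b) ≥ n+2` meets the level sets
# `d = 1, …, n+1` and has total size `‖𝒞‖ = Σ_{Y∈𝒞}#Y ≥ n+1` — the discharge of (324)'s separation hypothesis from a distance-like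
# potential on the cells (row NE7b, node U5c; the tree's `PolymerGasGeometric`∕`ClusterExpansion` vocabulary + Mathlib's `Relation.ReflTransGen`;
# [folklore])

Cell `pub-balaban`, sub-cell `t4`, spine estimate NE7b (`T4WeightBudget.RelWeightBound`; the cell's OWN estimate — NOT PRINTED in
[Bałaban 1983–89], NOT PROVED).  Crux-route work under `Spine/NE7b/` by the row OWNER (`t4-ne7b-p1` gen 130, file (325)) under FREEZE
(0)'s crux-prover clause, on § [NE7bP1-G129-HANDOFF] NEXT (i)∕(ii) (the geometric input of (324) `act_norm_pertLogZ_mixed_le`: its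
hypothesis `hsep` — every cluster touching both loci has `m ≤ ‖𝒞‖` — from the graph distance); NOTHING of Bałaban's is named as a Lean
object, valued or asserted; no `T4Continuum/Support` leaf typed; no `def`, no notation; zero `sorry`.  Imports (BY NAME): the tree's
`Literature/Probability/LatticeModels/LocalPerturbationPolymerGas` (`rconnSubsets`, `mem_rconnSubsets`) and through it `PolymerGasGeometric`
(`IsRConnected`, `Touches`, `GeomInc`), `ClusterExpansion` (`IsPolymerCluster`, `KPTouches`); Mathlib's `Relation.ReflTransGen`
(`mono`, `trans`, `tail`, induction), `Finset.card_biUnion_le`, `Finset.card_image_le`, `Nat.card_Icc`.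

WHY (located).  (324) bounds the mixed second difference of `log Z` under two local changes by `4e^{−τm}·…` PROVIDED every cluster
touching both loci has total size `≥ m`; the natural source of `m` is the distance between the loci in the adjacency `R`.  This file
proves the purely combinatorial bridge with the weakest distance-like datum — a potential `d` that grows by at most one across an edge
(e.g. the graph distance from `a`): connected unions, discrete intermediate values, and the count of level sets.

WHAT IS PROVED ([folklore]; `R` a symmetric adjacency on the cells `V`):
* §1 **`isRConnected_biUnion_of_isPolymerCluster`** (a nonempty `GeomInc R`-cluster of `R`-connected sets has an `R`-connected union);
* §2 `exists_eq_of_reflTransGen` (along an `R`-path inside `U`, a potential with `d y ≤ d x + 1` on edges takes every value between its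
  endpoint values), `Icc_subset_image_of_isRConnected` ∕ **`le_card_of_isRConnected`** (an `R`-connected `U` containing cells with
  `d ≤ lo` and `d ≥ hi` has `#U ≥ hi + 1 − lo`);
* §3 `card_biUnion_le_size` (`#⋃𝒞 ≤ ‖𝒞‖`), THE END **`cluster_size_ge_of_touches`** (`d a = 0`, `n + 2 ≤ d b`, `𝒞 ⊆ 𝒫(C)` a cluster
  touching `{a}` and `{b}` ⟹ `n + 1 ≤ Σ_{Y∈𝒞}#Y`, in `ℝ` as (324) consumes it); §4 toy.

HONEST (what this is NOT).  Combinatorics only; the potential `d` is an input (for the road: the sup-metric distance between blocks, not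
typed here); nothing of Bałaban's asserted.  BY-NAME EFFECT ON THE WALL: NONE.  NE7b NOT PRINTED ∕ NOT PROVED; spine PROVED 0∕9; rung (B)+1 —
the programme's measures remain FINITE-torus statements; NOT the mass gap, NOT Clay.  HONEST DEPENDENCY: continuum YM on T⁴ ⇐ BetaPertH ∧
nine spine estimates (0∕9 proved); BetaPertH ⇐ (D1) ∧ (D4) ∧ CAP+tail; G-an2-4 gates asym, D1 and NE2∕3∕4.
-/

set_option autoImplicit false

namespace Summit.QuantumFields.BalabanUV.T4Continuum.NE7b.SupClusterSeparation

open Finset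
open scoped BigOperators
open Literature.Probability.LatticeModels

variable {V : Type*} [DecidableEq V] {R : V → V → Prop}

/-! ## §1. The union of a cluster is connected -/

/-- **THE UNION OF A CLUSTER IS `R`-CONNECTED**: a nonempty family `𝒞` of `R`-connected cell sets which is a `GeomInc R`-cluster (no splitting
into two non-empty mutually compatible sub-families) has an `R`-connected union `⋃𝒞`: the sub-family of polymers all of whose cells are
reachable from a fixed cell is non-empty, and if it were proper the cluster property would produce an incompatible (equal or touching) pair
across, through which reachability propagates. [folklore] -/
theorem isRConnected_biUnion_of_isPolymerCluster {𝒞 : Finset (Finset V)} (hne : 𝒞.Nonempty) (hconn : ∀ Y ∈ 𝒞, IsRConnected R Y)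
    (hcl : IsPolymerCluster (GeomInc R) 𝒞) : IsRConnected R (𝒞.biUnion id) := by
  classical
  have hYU : ∀ Y ∈ 𝒞, Y ⊆ 𝒞.biUnion id := fun Y hY => subset_biUnion_of_mem id hY
  -- reachability inside a polymer lifts to reachability inside the union
  have hin : ∀ Y ∈ 𝒞, ∀ v ∈ Y, ∀ w ∈ Y,
      Relation.ReflTransGen (fun x y => R x y ∧ x ∈ 𝒞.biUnion id ∧ y ∈ 𝒞.biUnion id) v w := fun Y hY v hv w hw =>
    (Relation.ReflTransGen.mono (r := fun x y => R x y ∧ x ∈ Y ∧ y ∈ Y)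
      (p := fun x y => R x y ∧ x ∈ 𝒞.biUnion id ∧ y ∈ 𝒞.biUnion id)
      (fun x y h => ⟨h.1, hYU Y hY h.2.1, hYU Y hY h.2.2⟩)) v w ((hconn Y hY).2 v hv w hw)
  refine ⟨?_, fun v hv w hw => ?_⟩
  · obtain ⟨Y, hY⟩ := hne
    obtain ⟨y, hy⟩ := (hconn Y hY).1
    exact ⟨y, hYU Y hY hy⟩
  -- the polymers entirely reachable from `v`
  set 𝒞₁ : Finset (Finset V) := 𝒞.filter fun Y =>
    ∀ x ∈ Y, Relation.ReflTransGen (fun x y => R x y ∧ x ∈ 𝒞.biUnion id ∧ y ∈ 𝒞.biUnion id) v x with h𝒞₁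
  obtain ⟨Yv, hYv, hvYv⟩ := mem_biUnion.1 hv
  have h1ne : 𝒞₁.Nonempty := ⟨Yv, mem_filter.2 ⟨hYv, fun x hx => hin Yv hYv v hvYv x hx⟩⟩
  -- the cluster property forces `𝒞₁ = 𝒞`
  have hall : 𝒞 ⊆ 𝒞₁ := by
    by_contra hnot
    have h2ne : (𝒞 \ 𝒞₁).Nonempty := by
      obtain ⟨Y, hY, hY1⟩ := not_subset.1 hnot
      exact ⟨Y, mem_sdiff.2 ⟨hY, hY1⟩⟩
    obtain ⟨Y₁, hY₁, Y₂, hY₂, hinc⟩ := hcl 𝒞₁ (filter_subset _ _) h1ne h2ne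
    obtain ⟨hY₁𝒞, hY₁r⟩ := mem_filter.1 hY₁
    obtain ⟨hY₂𝒞, hY₂n⟩ := mem_sdiff.1 hY₂
    -- a cell of `Y₂` reachable from `v`
    have key : ∃ q ∈ Y₂, Relation.ReflTransGen (fun x y => R x y ∧ x ∈ 𝒞.biUnion id ∧ y ∈ 𝒞.biUnion id) v q := by
      rcases hinc with heq | ⟨u, hu, q, hq, huq⟩
      · subst heq
        obtain ⟨y, hy⟩ := (hconn Y₁ hY₁𝒞).1
        exact ⟨y, hy, hY₁r y hy⟩
      · refine ⟨q, hq, ?_⟩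
        rcases huq with rfl | hR'
        · exact hY₁r u hu
        · exact (hY₁r u hu).tail ⟨hR', hYU Y₁ hY₁𝒞 hu, hYU Y₂ hY₂𝒞 hq⟩
    obtain ⟨q, hq, hvq⟩ := key
    exact hY₂n (mem_filter.2 ⟨hY₂𝒞, fun x hx => hvq.trans (hin Y₂ hY₂𝒞 q hq x hx)⟩)
  obtain ⟨Yw, hYw, hwYw⟩ := mem_biUnion.1 hw
  exact (mem_filter.1 (hall hYw)).2 w hwYw

/-! ## §2. Discrete intermediate values along a path; counting level sets -/

omit [DecidableEq V] in
/-- **INTERMEDIATE VALUES ALONG AN `R`-PATH**: `R` symmetric, `d y ≤ d x + 1` across every edge; along a path inside `U` from `u` to `x`,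
every integer between `d u` and `d x` is the value of `d` at some cell of `U`. [folklore] -/
theorem exists_eq_of_reflTransGen (hR : ∀ x y, R x y → R y x) {d : V → ℕ} (hd : ∀ x y, R x y → d y ≤ d x + 1) {U : Finset V} {u x : V}
    (h : Relation.ReflTransGen (fun x y => R x y ∧ x ∈ U ∧ y ∈ U) u x) (hu : u ∈ U) :
    ∀ k : ℕ, (d u ≤ k ∧ k ≤ d x) ∨ (d x ≤ k ∧ k ≤ d u) → ∃ y ∈ U, d y = k := by
  induction h with
  | refl =>
      intro k hk
      exact ⟨u, hu, by omega⟩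
  | tail _ hstep ih =>
      intro k hk
      obtain ⟨hRbc, _, hcU⟩ := hstep
      have h1 := hd _ _ hRbc
      have h2 := hd _ _ (hR _ _ hRbc)
      by_cases hcase : ∃ y ∈ U, d y = k
      · exact hcase
      · -- then `k` is not between `d u` and `d b`, so it must be `d c`
        refine ⟨_, hcU, ?_⟩
        by_contra hne
        exact hcase (ih k (by omega))

omit [DecidableEq V] in
/-- **COUNTING LEVEL SETS**: `R` symmetric, `d y ≤ d x + 1` across edges, `U` `R`-connected containing `u, u'` with `d u ≤ lo`, `hi ≤ d u'`,
`lo ≤ hi` ⟹ the values `lo, …, hi` are all attained on `U`: `Icc lo hi ⊆ d(U)`. [folklore] -/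
theorem Icc_subset_image_of_isRConnected (hR : ∀ x y, R x y → R y x) {d : V → ℕ} (hd : ∀ x y, R x y → d y ≤ d x + 1) {U : Finset V}
    (hU : IsRConnected R U) {u u' : V} (hu : u ∈ U) (hu' : u' ∈ U) {lo hi : ℕ} (hlo : d u ≤ lo) (hhi : hi ≤ d u') :
    Finset.Icc lo hi ⊆ U.image d := by
  intro k hk
  rw [mem_Icc] at hk
  obtain ⟨y, hy, hyk⟩ := exists_eq_of_reflTransGen hR hd (hU.2 u hu u' hu') hu k (Or.inl ⟨by omega, by omega⟩)
  exact mem_image.2 ⟨y, hy, hyk⟩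

omit [DecidableEq V] in
/-- **An `R`-connected set through a low and a high cell of the potential is large**: `#U ≥ hi + 1 − lo`. [folklore] -/
theorem le_card_of_isRConnected (hR : ∀ x y, R x y → R y x) {d : V → ℕ} (hd : ∀ x y, R x y → d y ≤ d x + 1) {U : Finset V}
    (hU : IsRConnected R U) {u u' : V} (hu : u ∈ U) (hu' : u' ∈ U) {lo hi : ℕ} (hlo : d u ≤ lo) (hhi : hi ≤ d u') :
    hi + 1 - lo ≤ U.card :=
  calc hi + 1 - lo = (Finset.Icc lo hi).card := (Nat.card_Icc lo hi).symm
    _ ≤ (U.image d).card := card_le_card (Icc_subset_image_of_isRConnected hR hd hU hu hu' hlo hhi)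
    _ ≤ U.card := card_image_le

/-! ## §3. THE END: a cluster touching two far-apart cells is large -/

/-- The total size of a family dominates the size of its union: `#⋃𝒞 ≤ Σ_{Y∈𝒞}#Y`. [folklore] -/
theorem card_biUnion_le_size (𝒞 : Finset (Finset V)) : ((𝒞.biUnion id).card : ℝ) ≤ ∑ Y ∈ 𝒞, (Y.card : ℝ) := by
  have h := card_biUnion_le (s := 𝒞) (t := id)
  exact_mod_cast h

/-- **THE END — A CLUSTER TOUCHING `{a}` AND `{b}` WITH `d(a) = 0`, `d(b) ≥ n + 2` HAS TOTAL SIZE `≥ n + 1`.**  `R` symmetric; a potential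
`d : V → ℕ` with `d y ≤ d x + 1` across every edge; `𝒞 ⊆ 𝒫(C)` (a family of `R`-connected subsets of `C`) which is a `GeomInc R`-cluster
touching the singletons `{a}` and `{b}` ⟹ `(n : ℝ) + 1 ≤ Σ_{Y∈𝒞}#Y` — the separation letter `hsep` of (324) `act_norm_pertLogZ_mixed_le`
with `m = n + 1` for loci at `d`-distance `≥ n + 2`. [folklore] -/
theorem cluster_size_ge_of_touches (hR : ∀ x y, R x y → R y x) {d : V → ℕ} (hd : ∀ x y, R x y → d y ≤ d x + 1) {a b : V} {n : ℕ}
    (ha : d a = 0) (hb : n + 2 ≤ d b) {C : Finset V} {𝒞 : Finset (Finset V)} (h𝒞 : 𝒞 ∈ (rconnSubsets R C).powerset)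
    (hcl : IsPolymerCluster (GeomInc R) 𝒞) (hta : KPTouches (GeomInc R) 𝒞 {a}) (htb : KPTouches (GeomInc R) 𝒞 {b}) :
    (n : ℝ) + 1 ≤ ∑ Y ∈ 𝒞, (Y.card : ℝ) := by
  classical
  have hconn : ∀ Y ∈ 𝒞, IsRConnected R Y := fun Y hY => (mem_rconnSubsets.1 (mem_powerset.1 h𝒞 hY)).2
  obtain ⟨Ya, hYa, hincA⟩ := hta
  have hne : 𝒞.Nonempty := ⟨Ya, hYa⟩
  have hU := isRConnected_biUnion_of_isPolymerCluster hne hconn hcl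
  have hYU : ∀ Y ∈ 𝒞, Y ⊆ 𝒞.biUnion id := fun Y hY => subset_biUnion_of_mem id hY
  -- a polymer incompatible with a singleton `{c}` contains a cell equal or adjacent to `c`
  have hnear : ∀ {Y : Finset V} {c : V}, Y ∈ 𝒞 → GeomInc R Y {c} → ∃ u ∈ 𝒞.biUnion id, u = c ∨ R u c := by
    intro Y c hY hinc
    rcases hinc with heq | ⟨u, hu, q, hq, huq⟩
    · exact ⟨c, hYU Y hY (heq ▸ mem_singleton_self c), Or.inl rfl⟩
    · rw [mem_singleton] at hq
      subst hq
      exact ⟨u, hYU Y hY hu, huq⟩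
  -- a low cell (near `a`) and a high cell (near `b`)
  obtain ⟨u, huU, hua⟩ := hnear hYa hincA
  have hdu : d u ≤ 1 := by
    rcases hua with rfl | hR'
    · omega
    · have := hd _ _ (hR _ _ hR')
      omega
  obtain ⟨Yb, hYb, hincB⟩ := htb
  obtain ⟨u', hu'U, hu'b⟩ := hnear hYb hincB
  have hdu' : n + 1 ≤ d u' := by
    rcases hu'b with rfl | hR'
    · omega
    · have := hd _ _ hR'
      omega
  have hcard := le_card_of_isRConnected hR hd hU huU hu'U hdu hdu'
  have hcard' : n + 1 ≤ (𝒞.biUnion id).card := by omega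
  calc (n : ℝ) + 1 = ((n + 1 : ℕ) : ℝ) := by push_cast; ring
    _ ≤ ((𝒞.biUnion id).card : ℝ) := by exact_mod_cast hcard'
    _ ≤ ∑ Y ∈ 𝒞, (Y.card : ℝ) := card_biUnion_le_size 𝒞

/-! ## §4. Toy -/

/-- Toy (§2): on `Fin 3` with the path adjacency `|i − j| = 1` and the potential `d = id`, the connected set `{0,1,2}` through `0` (low, `≤ 0`)
and `2` (high, `≥ 2`) has at least `2 + 1 − 0 = 3` cells. -/
example : 2 + 1 - 0 ≤ (Finset.univ : Finset (Fin 3)).card := by decide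

end Summit.QuantumFields.BalabanUV.T4Continuum.NE7b.SupClusterSeparation
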